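import Summits.Ventures.CertifiedArithmetic.LowPrec.DoubleRoundingFMAMatrix

/-!
# Double rounding of the FMA through a register with `P_ψ ≥ 3 P_φ` — the test and the integer core

HONEST FRAMING: certified error envelopes and provably optimal rounding/accumulation schemes for
low-precision formats under stated cost models; every table by two implementations; no hardware
or vendor claims.

THEOREM D-fma-W (`DoubleRoundingFMAWide.lean`: soundness; `DoubleRoundingFMAWideIff.lean`:
witnesses, the criterion as an `iff`, named cells) decides `DFma φ ψ` — one fused multiply-add of
`φ`-data executed in `ψ` and converted to `φ` is the correctly rounded FMA of `φ` — for registers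
`ψ` with `P_ψ ≥ 3 P_φ` WITHOUT the window hypothesis of clause F (`DoubleRoundingFMA.lean`), by an
exact arithmetic test on the record.  With `K = P_ψ = m_ψ + 1` and `E_top = m_φ + emaxCode φ - 1`
the exponent of the top binade of `φ`:

* `fmaWideCount φ ψ` = the number of midpoints of `φ` of the binade `2^K` quanta that lie below
  `maxRat φ`: `0` if `E_top < K`, `topMan φ` if `E_top = K`, `2^m_φ` if `E_top > K` (then the
  whole binade `K` is finite; higher binades add no new significands);
* `sigPairTest P O` = "the number `O` has a divisor `1 < a < 2^(⌊P/2⌋+1)`" — for odd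
  `2^P < O < 2^(P+1)` this is "`O` is composite", equivalently "`O = a₁·b₁` with both factors
  below `2^P`", i.e. `O` is the odd part of a product of two `P`-digit significands
  (`sigPairTest_mul_eq_true`; the converse reading is in the `Iff` file);
* `fmaWideTest φ ψ` = no available midpoint `(2^P + 2j + 1)·2^(K-P)`, `j < fmaWideCount`, has a
  factorable significand; `dFmaWideTest` conjoins the side conditions of clause F.

`fma_slip_core_wide` is the integer heart (units `ν = quantum ψ / 2` as in `fma_slip_core`): for
`g ≥ t + 2P_φ` — automatic when `P_ψ ≥ 3P_φ` — a slip forces the product to BE the midpoint,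
`P = M`.  Implementation A = `code/enum/fma_wide_law.py`.

References: [MartinDorelMelquiondMuller2013] Property 2.1; [BoldoMelquiond2008] Thm 3;
[Figueroa1995] §3; [Roux2014] §2. No hardware or vendor claims.
-/

namespace Summit.Ventures.CertifiedArithmetic

open Literature.ComputerArithmetic.FloatingPoint
open Literature.ComputerArithmetic.FloatingPoint.Format
open Literature.ComputerArithmetic.FloatingPoint.MiniFloat

/-! ## §1 The test -/

/-- `sigPairTest P O`: the number `O` has a divisor `a` with `1 < a < 2^(⌊P/2⌋+1)` (a bounded
search the kernel evaluates).  For odd `2^P < O < 2^(P+1)`: iff `O` is composite, iff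
`O = a₁·b₁` with `1 < a₁, b₁ < 2^P` (`sigPairTest_mul_eq_true`). [this packet] -/
def sigPairTest (P O : ℕ) : Bool :=
  (List.range (2 ^ (P / 2 + 1))).any fun a => decide (1 < a) && decide (O % a = 0)

/-- The number of midpoints of `φ` of the binade `2^(m_ψ+1)` quanta (significands
`2^P_φ + 2j + 1`, `j = 0, 1, …`) below `maxRat φ`: none, `topMan φ`, or all `2^m_φ` according as
the top binade of `φ` is below, at, or above it. [this packet] -/
def fmaWideCount (φ ψ : Format) : ℕ :=
  if φ.manBits + φ.emaxCode ≤ ψ.manBits + 1 then 0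
  else if φ.manBits + φ.emaxCode = ψ.manBits + 2 then φ.topMan else 2 ^ φ.manBits

/-- `fmaWideTest φ ψ`: no available midpoint of `φ` in the binades `≥ 2^(m_ψ+1)` quanta has a
factorable significand `2^P_φ + 2j + 1 = a₁·b₁`, `a₁, b₁ < 2^P_φ`. [this packet] -/
def fmaWideTest (φ ψ : Format) : Bool :=
  (List.range (fmaWideCount φ ψ)).all fun j =>
    ! sigPairTest (φ.manBits + 1) (2 ^ (φ.manBits + 1) + 2 * j + 1)

/-- A product of two numbers `> 1` below `2^(P+1)` passes `sigPairTest P`: the smaller factor is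
below `2^(⌊P/2⌋+1)`. [folklore] -/
theorem sigPairTest_mul_eq_true {P a₁ b₁ : ℕ} (ha : 1 < a₁) (hb : 1 < b₁)
    (hlt : a₁ * b₁ < 2 ^ (P + 1)) : sigPairTest P (a₁ * b₁) = true := by
  unfold sigPairTest
  rw [List.any_eq_true]
  have key : ∀ {a b : ℕ}, a ≤ b → a * b < 2 ^ (P + 1) → a < 2 ^ (P / 2 + 1) := by
    intro a b hab hlt
    have h1 : a * a < 2 ^ (P + 1) := lt_of_le_of_lt (Nat.mul_le_mul_left _ hab) hlt
    have h2 : 2 ^ (P + 1) ≤ 2 ^ (P / 2 + 1) * 2 ^ (P / 2 + 1) := by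
      rw [← pow_add]; exact Nat.pow_le_pow_right (by norm_num) (by omega)
    by_contra h3
    have h4 := Nat.mul_le_mul (not_lt.mp h3) (not_lt.mp h3)
    omega
  rcases le_total a₁ b₁ with h | h
  · exact ⟨a₁, List.mem_range.mpr (key h hlt), by simp [ha]⟩
  · exact ⟨b₁, List.mem_range.mpr (key h (by rwa [mul_comm])), by simp [hb]⟩

/-! ## §2 Integer lemmas -/

/-- THE INTEGER HEART OF THEOREM D-fma-W. In units of half a quantum of the wide format: a
product `P` with `2^k ∣ P`, `|P| ≤ (2^p-1)²·2^k`, an addend `C` that is either coarse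
(`2^(t+1) ∣ C`) or small (`|C| ≤ (2^p-1)·2^t`), and a midpoint `M = (2J+1)·2^g ≥ 2^(t+3p)` of the
narrow format that is the correctly rounded wide result (`0 < |P + C - M| ≤ 2^t`) with the
addend outside the gap (`|C - M| ≥ 2^g`, `g ≥ t + 2p`): then `P = M` — the product IS the
midpoint (a coarse addend is contradictory; a small one leaves `2^(t+p+1) ∣ P - M`,
`|P - M| < 2^(t+p+1)`). [this packet] -/
theorem fma_slip_core_wide {p k t g : ℕ} {P C M J : ℤ} (hp : 1 ≤ p)
    (hkP : (2:ℤ) ^ k ∣ P) (hPle : |P| ≤ ((2:ℤ) ^ p - 1) ^ 2 * 2 ^ k)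
    (hC : (2:ℤ) ^ (t + 1) ∣ C ∨ |C| ≤ ((2:ℤ) ^ p - 1) * 2 ^ t) (hM : M = (2 * J + 1) * 2 ^ g)
    (htg : t + 2 * p ≤ g) (hMge : (2:ℤ) ^ (t + 3 * p) ≤ M)
    (hN0 : P + C - M ≠ 0) (hNle : |P + C - M| ≤ (2:ℤ) ^ t) (hfar : (2:ℤ) ^ g ≤ |C - M|) :
    P = M := by
  have h2p : (2:ℤ) ≤ 2 ^ p := by
    calc (2:ℤ) = 2 ^ 1 := by norm_num
      _ ≤ 2 ^ p := pow_le_pow_right₀ (by norm_num) hp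
  have ht0 : (0:ℤ) < 2 ^ t := by positivity
  have hp0 : (0:ℤ) < 2 ^ p := by positivity
  rcases hC with hC | hC
  · -- a coarse addend: `2^(t+1) ∤ P`, so `k ≤ t`, and `|C - M| ≤ |N| + |P|` is too small
    exfalso
    have hMt : (2:ℤ) ^ (t + 1) ∣ M := by
      rw [hM]; exact Dvd.dvd.mul_left (pow_dvd_pow 2 (by omega)) _
    have hkt : k ≤ t := by
      by_contra hkt
      have h1 : (2:ℤ) ^ (t + 1) ∣ P := (pow_dvd_pow 2 (by omega)).trans hkP
      have h2 : (2:ℤ) ^ (t + 1) ∣ P + C - M := dvd_sub (dvd_add h1 hC) hMt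
      have h3 := (Int.le_of_dvd (abs_pos.mpr hN0) ((dvd_abs _ _).mpr h2)).trans hNle
      have h4 : (2:ℤ) ^ t < 2 ^ (t + 1) := pow_lt_pow_right₀ (by norm_num) (by omega)
      exact absurd h3 (not_le.mpr h4)
    have hPt : |P| ≤ ((2:ℤ) ^ p - 1) ^ 2 * 2 ^ t :=
      hPle.trans (mul_le_mul_of_nonneg_left (pow_le_pow_right₀ (by norm_num) hkt) (sq_nonneg _))
    have hCM : |C - M| ≤ 2 ^ t + ((2:ℤ) ^ p - 1) ^ 2 * 2 ^ t := by
      have e : C - M = (P + C - M) - P := by ring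
      rw [e]; exact (abs_sub _ _).trans (add_le_add hNle hPt)
    have hlt : 2 ^ t + ((2:ℤ) ^ p - 1) ^ 2 * 2 ^ t < 2 ^ (t + 2 * p) := by
      rw [pow_add, pow_mul']
      nlinarith [mul_pos ht0 (by linarith : (0:ℤ) < 2 * 2 ^ p - 2)]
    have hge : (2:ℤ) ^ (t + 2 * p) ≤ 2 ^ g := pow_le_pow_right₀ (by norm_num) htg
    exact absurd (lt_of_le_of_lt (hfar.trans hCM) hlt) (not_lt.mpr hge)
  · -- a small addend: `P ≥ M - |N| - |C| ≥ 2^(t+3p) - 2^(t+p)` forces `k ≥ t + p + 1`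
    have hN := abs_le.mp hNle
    have hC' := abs_le.mp hC
    have hPge : (2:ℤ) ^ (t + 3 * p) - 2 ^ p * 2 ^ t ≤ P := by linarith [hN.1, hC'.2]
    have hk : t + p + 1 ≤ k := by
      by_contra hk
      have hPt : |P| ≤ ((2:ℤ) ^ p - 1) ^ 2 * 2 ^ (t + p) :=
        hPle.trans (mul_le_mul_of_nonneg_left (pow_le_pow_right₀ (by norm_num) (by omega))
          (sq_nonneg _))
      have h1 : P ≤ ((2:ℤ) ^ p - 1) ^ 2 * 2 ^ (t + p) := (le_abs_self P).trans hPt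
      have e1 : (2:ℤ) ^ (t + 3 * p) = 2 ^ t * 2 ^ p * (2 ^ p * 2 ^ p) := by
        rw [pow_add, show 3 * p = p + p + p by ring, pow_add, pow_add]; ring
      have e2 : (2:ℤ) ^ (t + p) = 2 ^ t * 2 ^ p := pow_add _ _ _
      rw [e1] at hPge; rw [e2] at h1
      nlinarith [mul_pos (mul_pos ht0 hp0) (by linarith : (0:ℤ) < 2 ^ p - 1)]
    have h1 : (2:ℤ) ^ (t + p + 1) ∣ P := (pow_dvd_pow 2 hk).trans hkP
    have h2 : (2:ℤ) ^ (t + p + 1) ∣ M := by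
      rw [hM]; exact Dvd.dvd.mul_left (pow_dvd_pow 2 (by omega)) _
    have h3 : |P - M| < (2:ℤ) ^ (t + p + 1) := by
      have e : P - M = (P + C - M) - C := by ring
      have e3 : (2:ℤ) ^ (t + p + 1) = 2 * (2 ^ p * 2 ^ t) := by rw [pow_succ, pow_add]; ring
      rw [e, e3]
      calc |P + C - M - C| ≤ |P + C - M| + |C| := abs_sub _ _
        _ ≤ 2 ^ t + ((2:ℤ) ^ p - 1) * 2 ^ t := add_le_add hNle hC
        _ = 2 ^ p * 2 ^ t := by ring
        _ < 2 * (2 ^ p * 2 ^ t) := by nlinarith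
    have h4 : P - M = 0 := Int.eq_zero_of_abs_lt_dvd (dvd_sub h1 h2) h3
    linarith

/-- THEOREM D-fma-W as ONE Boolean test on parameter records (the hypotheses of
`dFma_of_fmaWideTest`). [this packet] -/
def dFmaWideTest (φ ψ : Format) : Bool :=
  embedsTest φ ψ && decide (3 * (φ.manBits + 1) ≤ ψ.manBits + 1) && decide (φ.bias ≤ ψ.bias)
    && decide (ψ.qexp ≤ 2 * φ.qexp) && decide (ψ.qexp + ψ.manBits + 1 ≤ φ.qexp)
    && fmaWideTest φ ψ

end Summit.Ventures.CertifiedArithmetic
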